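import Literature.MathematicalPhysics.QuantumFieldTheory.Dimock2011to13.QED3BlockPotentialSums
import Literature.MathematicalPhysics.QuantumFieldTheory.Balaban1983to89.B12Decay510Torus
import HarnessLib

/-!
# Dimock, *QED on the 3-torus. II*, §3.1 (128) and LEMMA 1 (129)–(131), §3.2 (154) and §3.3 (202)–(203), ON THE TORUS
# itself: the block sums of `d′(x,y)^{−α}` for the PERIODIC `d′` of the discrete 3-torus `(ℤ∕N)³` — PROVED from the
# tree's `ℤ³` member by minimal lifts (every `O(1)` the same closed-form constant)

statement-level skeleton of published theorems with citation tags; proofs where landed; nothing here is a claim about the Yang–Mills mass gap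

**Citation header (reproduction of PUBLISHED work).** J. Dimock, *Quantum electrodynamics on the 3-torus. II. The
renormalization group flow*, arXiv:math-ph/0407063 (2004) [Dimock2004QED3TorusII], §3.1 (128), LEMMA 1 (129)–(131)
p.21 L16–57, §3.2 proof of THEOREM 1 Part III (154) p.24 L94 – p.25 L1 and §3.3 proof of THEOREM 2 (202)–(203) p.30 L75 –
p.31 L5, of the held arXiv text layer
`paper:arxiv-math-ph_0407063` (`p.NN Lnn` = PDF page ∕ text-layer line).  Writer seat p11
(literature-prover-lit-balaban-p11-g24-0), YM LIT SWEEP item (c) D13 (row C13 «WHERE»; zero weight for the YM-INPRINT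
tokens).  Imports the tree's `QED3BlockPotentialSums` (the `ℤ³` member: `dOne`, `supN`, `blockConst`, `sum_block_le`,
`eq129`, `rpow_neg_mul_rpow_neg_le`) and `Balaban1983to89.B12Decay510Torus` (the torus carrier `TPt d N = (ℤ∕N)^d` with
the minimal-lift vector `vmaVec`, `vmaVec_injective`, `pabs_add_le`).

**The printed statements.**  p.21 L16–34: *"Finally we introduce some modified distances on `T^{−k}_{N+M−k}` … For
short distances we use `d′(x,y) = d(x,y)` (`x ≠ y`), `L^{−k}` (`x = y`) (128). This is not a real metric but it does
satisfy the triangle inequality, and it does scale like `d(x,y)`. … We note the following estimates on integrals in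
`T^{−k}_{N+M−k}`. As usual `∫dy[⋯] = Σ_y L^{−3k}[⋯]`. The estimates refer to `L^{−(k−i)}` blocks `Δ`"*; LEMMA 1 p.21
L36–42: *"Let `Δ` be an `L^{−(k−i)}` block with `1 ≤ i ≤ k` and let `0 ≤ α < 3`: `∫_Δ d′(x,y)^{−α}dy ≤ O(L^{−(3−α)(k−i)})`
(129) `∫_Δ d′(x,y)^{−α}d′(y,z)^{−α}dy ≤ O(L^{−(3−α)(k−i)})d′(x,z)^{−α}` (130) `∫_Δ d′(x,y)^{−1}d′(y,z)^{−2}dy ≤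
O(L^{−(k−i)})d′(x,z)^{−1}` (131)"*; (154) p.24 L95–99: *"Then repeatedly use
the estimate `L^{k−i_j}∫_{Δ_j}d′(x_{j−1},x_j)^{−2}d′(x_j,x_{j+1})^{−2}dx_j ≤ O(d′(x_{j−1},x_{j+1})^{−2})` (154) which follow
from (130)."*

**What is formalized (kernel-checked, zero `sorry`, no named facts).**  The tree's `QED3BlockPotentialSums` proves
(128)–(131) on the `ℤ³` LATTICE member (`d′ = η·dOne(x − y)`, `dOne n = max(1,|n|∞)`); the paper states them on the
TORUS.  Here the torus member: sites of `(ℤ∕N)³` (`TPt 3 N`), `d′_T(x,y) := η·dOne(vmaVec(x − y))` — the sup norm of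
the MINIMAL LIFT of `x − y`, i.e. the periodic sup-distance floored at one spacing:
* (128) on the torus: `dOne_vmaVec_sub_comm` (symmetry, via `|valMinAbs(−a)| = |valMinAbs a|`), `supN_vmaVec_add_le`
  and **`dOne_vmaVec_triangle`** (*"it does satisfy the triangle inequality"*, via `pabs_add_le`), `dprimeT_pos`;
* **(129) on the torus**, `eq129_torus`: `Σ_{y∈U}η³·d′_T(x,y)^{−α} ≤ C(α)(ηR)^{3−α}` for every `U ⊂ (ℤ∕N)³` with
  `#U ≤ R³` — by REINDEXING `y ↦ vmaVec(y − x) ∈ ℤ³` (injective) into the tree's `eq129` at centre `0`;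
* **(130) on the torus**, `eq130_torus`: `Σ_{y∈U}η³·d′_T(x,y)^{−α}d′_T(y,z)^{−α} ≤ 2^{α+1}C(α)(ηR)^{3−α}d′_T(x,z)^{−α}` — the
  printed two-case argument (`rpow_neg_mul_rpow_neg_le` BY NAME) with the periodic triangle inequality and (129)_T;
* **(131) on the torus**, `eq131_torus`: `≤ √8·C(2)(ηR)·d′_T(x,z)^{−1}` — the Schwarz-inequality step of the printed proof;
* **(154) on the torus**, `hconv_torus` ((130)_T at `α = 2`) and **`hconv_shape_torus`**: the block convolution
  hypothesis `hconv` ∕ `hconv₀` of the tree's `dimock_thm1` ∕ `dimock_thm1_torus` in its EXACT shape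
  `Σ_{y : Δ_y = b} 1·(Q(u,y)Q(y,v)) ≤ θ·Q(u,v)` for the printed profile `Q(u,v) = η³·d′_T(e u, e v)^{−2}` on any site set
  embedded in the torus (`e` injective) whose blocks have `≤ R³` sites, `θ = 2³C(2)(ηR)`;
* **(202)–(203) on the torus** (THEOREM 2, bosons, profile `d′^{−1} + d′^{−2}`): `hconv_torus_boson`, `hconv₀_torus_boson`
  (the tree's `hconv_Z3_boson` ∕ `hconv₀_Z3_boson`, ported) and their `dimock_thm1`-shapes `hconv_shape_torus_boson`,
  `hconv₀_shape_torus_boson` via the generic `conv_shape_of_torus`.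

**Readings ∕ honest scope.**  Sup norm for `|x − y|` (paper I (21)); `∫_Δ dy = Σ_{y∈Δ} η³` with `η = L^{−k}`; a block
enters only through `#Δ ≤ R³` (`R = L^i` sites per side, `ηR = L^{−(k−i)}`); for `N` smaller than a block the torus
wraps and the statements remain true (upper bounds).  The long-distance metric `d_Λ` (127) is not treated here.  No `d = 4` statement; nothing about Bałaban's papers beyond the reuse of the cell's torus carrier.
-/

noncomputable section

open Finset Real

namespace Literature.MathematicalPhysics.QuantumFieldTheory.Dimock2011to13

namespace QED3TorusII

open Balaban1983to89.TreeLengthTorus (TPt)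
open Balaban1983to89.B12Decay510Torus (vmaVec vmaVec_injective pabs pabs_eq_natAbs pabs_add_le)

variable {N : ℕ} [NeZero N]

/-! ## §1 (128) on the torus: the periodic `d′` is symmetric, `≥` one spacing, and satisfies the triangle inequality -/

omit [NeZero N] in
/-- `|−v|∞ = |v|∞` for minimal lifts on the torus (`|valMinAbs(−a)| = |valMinAbs a|`).
[cite: Dimock2004QED3TorusII, §3.1 (128) p.21 L24–28] -/
theorem supN_vmaVec_neg (v : TPt 3 N) : supN (vmaVec (-v)) = supN (vmaVec v) := by
  unfold supN
  congr 1
  funext j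
  show ((-v) j).valMinAbs.natAbs = (v j).valMinAbs.natAbs
  rw [Pi.neg_apply, ZMod.natAbs_valMinAbs_neg]

omit [NeZero N] in
/-- `dOne` of a minimal lift is even. [cite: Dimock2004QED3TorusII, §3.1 (128) p.21 L24–28] -/
theorem dOne_vmaVec_neg (v : TPt 3 N) : dOne (vmaVec (-v)) = dOne (vmaVec v) := by
  unfold dOne
  rw [supN_vmaVec_neg]

omit [NeZero N] in
/-- **symmetry of the periodic `d′`**: `d′_T(x,y) = d′_T(y,x)`. [cite: Dimock2004QED3TorusII, §3.1 (128) p.21 L24–28] -/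
theorem dOne_vmaVec_sub_comm (x y : TPt 3 N) : dOne (vmaVec (x - y)) = dOne (vmaVec (y - x)) := by
  rw [← neg_sub, dOne_vmaVec_neg]

/-- `|a + b|∞ ≤ |a|∞ + |b|∞` for minimal lifts on the torus (coordinatewise `|a + b|_N ≤ |a|_N + |b|_N`,
`pabs_add_le`). [cite: Dimock2004QED3TorusII, §3.1 (128) p.21 L28 («it does satisfy the triangle inequality»)] -/
theorem supN_vmaVec_add_le (a b : TPt 3 N) : supN (vmaVec (a + b)) ≤ supN (vmaVec a) + supN (vmaVec b) := by
  unfold supN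
  refine Finset.sup_le fun j _ => ?_
  have h1 : ((vmaVec (a + b) j).natAbs : ℤ) ≤ (vmaVec a j).natAbs + (vmaVec b j).natAbs := by
    have h := pabs_add_le (a j) (b j)
    rw [pabs_eq_natAbs, pabs_eq_natAbs, pabs_eq_natAbs] at h
    exact h
  have h2 : (vmaVec (a + b) j).natAbs ≤ (vmaVec a j).natAbs + (vmaVec b j).natAbs := by exact_mod_cast h1
  calc (vmaVec (a + b) j).natAbs ≤ (vmaVec a j).natAbs + (vmaVec b j).natAbs := h2
    _ ≤ (univ.sup fun j => (vmaVec a j).natAbs) + (univ.sup fun j => (vmaVec b j).natAbs) :=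
        add_le_add (Finset.le_sup (f := fun j => (vmaVec a j).natAbs) (mem_univ j))
          (Finset.le_sup (f := fun j => (vmaVec b j).natAbs) (mem_univ j))

/-- **(128) on the torus, the triangle inequality**: `dOne(vmaVec(x − z)) ≤ dOne(vmaVec(x − y)) + dOne(vmaVec(y − z))`.
[cite: Dimock2004QED3TorusII, §3.1 (128) p.21 L28 («This is not a real metric but it does satisfy the triangle inequality»)] -/
theorem dOne_vmaVec_triangle (x y z : TPt 3 N) :
    dOne (vmaVec (x - z)) ≤ dOne (vmaVec (x - y)) + dOne (vmaVec (y - z)) := by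
  have h1 : (supN (vmaVec (x - z)) : ℝ) ≤ supN (vmaVec (x - y)) + supN (vmaVec (y - z)) := by
    have : x - z = (x - y) + (y - z) := by abel
    rw [this]
    exact_mod_cast supN_vmaVec_add_le (x - y) (y - z)
  unfold dOne
  refine max_le ?_ ?_
  · linarith [le_max_left (1 : ℝ) (supN (vmaVec (x - y)) : ℝ), le_max_left (1 : ℝ) (supN (vmaVec (y - z)) : ℝ)]
  · linarith [le_max_right (1 : ℝ) (supN (vmaVec (x - y)) : ℝ),
      le_max_right (1 : ℝ) (supN (vmaVec (y - z)) : ℝ)]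

omit [NeZero N] in
/-- `d′_T > 0` for spacing `η > 0`. [cite: Dimock2004QED3TorusII, §3.1 (128) p.21 L24–27] -/
theorem dprimeT_pos {η : ℝ} (hη : 0 < η) (x y : TPt 3 N) : 0 < η * dOne (vmaVec (x - y)) :=
  mul_pos hη (dOne_pos _)

/-- **(128) on the torus with the spacing**: `d′_T(x,z) ≤ d′_T(x,y) + d′_T(y,z)`, `d′_T(x,y) = η·dOne(vmaVec(x − y))`.
[cite: Dimock2004QED3TorusII, §3.1 (128) p.21 L24–28] -/
theorem dprimeT_triangle {η : ℝ} (hη : 0 ≤ η) (x y z : TPt 3 N) :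
    η * dOne (vmaVec (x - z)) ≤ η * dOne (vmaVec (x - y)) + η * dOne (vmaVec (y - z)) := by
  rw [← mul_add]
  exact mul_le_mul_of_nonneg_left (dOne_vmaVec_triangle x y z) hη

/-! ## §2 LEMMA 1 (129)–(130) on the torus -/

omit [NeZero N] in
/-- **LEMMA 1 (129) ON THE TORUS**: `∫_Δ d′_T(x,y)^{−α}dy = Σ_{y∈U}η³(η·dOne(vmaVec(x − y)))^{−α} ≤ C(α)(ηR)^{3−α}` for every
`x ∈ (ℤ∕N)³`, every `U ⊂ (ℤ∕N)³` with `#U ≤ R³` (`R ≥ 1`), `η > 0`, `0 ≤ α < 3` — by reindexing `y ↦ vmaVec(y − x) ∈ ℤ³`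
(injective) into the tree's `ℤ³` member `eq129`. [cite: Dimock2004QED3TorusII, §3.1 Lemma 1 (129) p.21 L36–39, proof L46–51] -/
theorem eq129_torus {α η : ℝ} (hα0 : 0 ≤ α) (hα3 : α < 3) (hη : 0 < η) (U : Finset (TPt 3 N)) {R : ℕ}
    (hR : 1 ≤ R) (hcard : U.card ≤ R ^ 3) (x : TPt 3 N) :
    ∑ y ∈ U, η ^ 3 * (η * dOne (vmaVec (x - y))) ^ (-α) ≤ blockConst α * (η * R) ^ (3 - α) := by
  classical
  have hinj : ∀ y ∈ U, ∀ y' ∈ U, (fun y : TPt 3 N => vmaVec (y - x)) y = (fun y => vmaVec (y - x)) y' → y = y' :=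
    fun y _ y' _ h => sub_left_injective (vmaVec_injective h)
  have hcard' : (U.image fun y => vmaVec (y - x)).card ≤ R ^ 3 := card_image_le.trans hcard
  have h := eq129 hα0 hα3 hη (U.image fun y => vmaVec (y - x)) hR hcard' 0
  unfold blockIntegral dprime at h
  rw [sum_image hinj] at h
  refine le_trans (le_of_eq (sum_congr rfl fun y _ => ?_)) h
  show η ^ 3 * (η * dOne (vmaVec (x - y))) ^ (-α) = η ^ 3 * (η * dOne (0 - vmaVec (y - x))) ^ (-α)
  rw [zero_sub, dOne_neg, dOne_vmaVec_sub_comm]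

/-- **LEMMA 1 (130) ON THE TORUS**: `Σ_{y∈U}η³·d′_T(x,y)^{−α}d′_T(y,z)^{−α} ≤ 2^{α+1}C(α)(ηR)^{3−α}d′_T(x,z)^{−α}` — the printed two
cases `d′(x,y) ≥ d′(x,z)∕2` ∕ `d′(y,z) ≥ d′(x,z)∕2` (the tree's `rpow_neg_mul_rpow_neg_le`) with the PERIODIC triangle
inequality, then (129) on the torus twice. [cite: Dimock2004QED3TorusII, §3.1 Lemma 1 (130) p.21 L40–42, proof L52–55] -/
theorem eq130_torus {α η : ℝ} (hα0 : 0 ≤ α) (hα3 : α < 3) (hη : 0 < η) (U : Finset (TPt 3 N)) {R : ℕ}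
    (hR : 1 ≤ R) (hcard : U.card ≤ R ^ 3) (x z : TPt 3 N) :
    ∑ y ∈ U, η ^ 3 * ((η * dOne (vmaVec (x - y))) ^ (-α) * (η * dOne (vmaVec (y - z))) ^ (-α))
      ≤ 2 ^ (α + 1) * blockConst α * (η * R) ^ (3 - α) * (η * dOne (vmaVec (x - z))) ^ (-α) := by
  have hη3 : 0 ≤ η ^ 3 := pow_nonneg hη.le 3
  have hpt : ∀ y ∈ U, η ^ 3 * ((η * dOne (vmaVec (x - y))) ^ (-α) * (η * dOne (vmaVec (y - z))) ^ (-α))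
      ≤ 2 ^ α * (η * dOne (vmaVec (x - z))) ^ (-α) * (η ^ 3 * (η * dOne (vmaVec (x - y))) ^ (-α))
        + 2 ^ α * (η * dOne (vmaVec (x - z))) ^ (-α) * (η ^ 3 * (η * dOne (vmaVec (z - y))) ^ (-α)) := by
    intro y _
    have h := rpow_neg_mul_rpow_neg_le (dprimeT_pos hη x y) (dprimeT_pos hη y z) (dprimeT_pos hη x z) hα0
      (dprimeT_triangle hη.le x y z)
    rw [dOne_vmaVec_sub_comm z y]
    calc η ^ 3 * ((η * dOne (vmaVec (x - y))) ^ (-α) * (η * dOne (vmaVec (y - z))) ^ (-α))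
        ≤ η ^ 3 * (2 ^ α * (η * dOne (vmaVec (x - z))) ^ (-α) *
            ((η * dOne (vmaVec (x - y))) ^ (-α) + (η * dOne (vmaVec (y - z))) ^ (-α))) :=
          mul_le_mul_of_nonneg_left h hη3
      _ = _ := by ring
  have hc : 0 ≤ 2 ^ α * (η * dOne (vmaVec (x - z))) ^ (-α) :=
    mul_nonneg (Real.rpow_nonneg zero_le_two _) (Real.rpow_nonneg (dprimeT_pos hη x z).le _)
  have h1 := eq129_torus hα0 hα3 hη U hR hcard x
  have h2 := eq129_torus hα0 hα3 hη U hR hcard z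
  calc ∑ y ∈ U, η ^ 3 * ((η * dOne (vmaVec (x - y))) ^ (-α) * (η * dOne (vmaVec (y - z))) ^ (-α))
      ≤ ∑ y ∈ U, (2 ^ α * (η * dOne (vmaVec (x - z))) ^ (-α) * (η ^ 3 * (η * dOne (vmaVec (x - y))) ^ (-α))
          + 2 ^ α * (η * dOne (vmaVec (x - z))) ^ (-α) * (η ^ 3 * (η * dOne (vmaVec (z - y))) ^ (-α))) :=
        sum_le_sum hpt
    _ = 2 ^ α * (η * dOne (vmaVec (x - z))) ^ (-α) *
          (∑ y ∈ U, η ^ 3 * (η * dOne (vmaVec (x - y))) ^ (-α)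
            + ∑ y ∈ U, η ^ 3 * (η * dOne (vmaVec (z - y))) ^ (-α)) := by
        rw [sum_add_distrib, mul_add, mul_sum, mul_sum]
    _ ≤ 2 ^ α * (η * dOne (vmaVec (x - z))) ^ (-α) *
          (blockConst α * (η * R) ^ (3 - α) + blockConst α * (η * R) ^ (3 - α)) :=
        mul_le_mul_of_nonneg_left (add_le_add h1 h2) hc
    _ = 2 ^ (α + 1) * blockConst α * (η * R) ^ (3 - α) * (η * dOne (vmaVec (x - z))) ^ (-α) := by
        rw [Real.rpow_add_one two_ne_zero]; ring


/-- **LEMMA 1 (131) ON THE TORUS**: `Σ_{y∈U}η³·d′_T(x,y)^{−1}d′_T(y,z)^{−2} ≤ √8·C(2)·(ηR)·d′_T(x,z)^{−1}` — «regard the integrand as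
the product of `d′(x,y′)^{−1}d′(y′,z)^{−1}` and `d′(y′,z)^{−1}` and use the Schwarz inequality», then (130) and (129) on the
torus at `α = 2` (the tree's `eq131` argument, ported). [cite: Dimock2004QED3TorusII, §3.1 Lemma 1 (131) p.21 L43–45, proof L56–57] -/
theorem eq131_torus {η : ℝ} (hη : 0 < η) (U : Finset (TPt 3 N)) {R : ℕ} (hR : 1 ≤ R) (hcard : U.card ≤ R ^ 3)
    (x z : TPt 3 N) :
    ∑ y ∈ U, η ^ 3 * ((η * dOne (vmaVec (x - y))) ^ (-(1 : ℝ)) * (η * dOne (vmaVec (y - z))) ^ (-(2 : ℝ)))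
      ≤ Real.sqrt 8 * blockConst 2 * (η * R) * (η * dOne (vmaVec (x - z))) ^ (-(1 : ℝ)) := by
  set f : TPt 3 N → ℝ := fun y =>
    (η * dOne (vmaVec (x - y))) ^ (-(1 : ℝ)) * (η * dOne (vmaVec (y - z))) ^ (-(1 : ℝ)) with hf
  set g : TPt 3 N → ℝ := fun y => (η * dOne (vmaVec (y - z))) ^ (-(1 : ℝ)) with hg
  have hd := fun (a b : TPt 3 N) => dprimeT_pos hη a b
  have hfg : ∀ y, (η * dOne (vmaVec (x - y))) ^ (-(1 : ℝ)) * (η * dOne (vmaVec (y - z))) ^ (-(2 : ℝ))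
      = f y * g y := by
    intro y
    simp only [hf, hg]
    rw [show (-(2 : ℝ)) = -(1 : ℝ) + -(1 : ℝ) by norm_num, Real.rpow_add (hd y z)]
    ring
  have hsq : ∀ (t : ℝ), 0 < t → (t ^ (-(1 : ℝ))) ^ 2 = t ^ (-(2 : ℝ)) := by
    intro t ht
    rw [← Real.rpow_natCast (t ^ (-(1 : ℝ))) 2, ← Real.rpow_mul ht.le]
    norm_num
  have hf2 : ∀ y, f y ^ 2 = (η * dOne (vmaVec (x - y))) ^ (-(2 : ℝ)) * (η * dOne (vmaVec (y - z))) ^ (-(2 : ℝ)) := by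
    intro y; simp only [hf]; rw [mul_pow, hsq _ (hd x y), hsq _ (hd y z)]
  have hg2 : ∀ y, g y ^ 2 = (η * dOne (vmaVec (z - y))) ^ (-(2 : ℝ)) := by
    intro y; simp only [hg]; rw [dOne_vmaVec_sub_comm y z, hsq _ (hd z y)]
  have h130 := eq130_torus (α := 2) (by norm_num) (by norm_num) hη U hR hcard x z
  have h129 := eq129_torus (α := 2) (by norm_num) (by norm_num) hη U hR hcard z
  have h8 : (2 : ℝ) ^ ((2 : ℝ) + 1) = 8 := by
    rw [show (2 : ℝ) + 1 = ((3 : ℕ) : ℝ) by norm_num, Real.rpow_natCast]; norm_num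
  have hηR1 : (η * R) ^ ((3 : ℝ) - 2) = η * R := by
    rw [show (3 : ℝ) - 2 = 1 by norm_num, Real.rpow_one]
  rw [h8, hηR1] at h130
  rw [hηR1] at h129
  have hη3 : 0 ≤ η ^ 3 := pow_nonneg hη.le 3
  have hF : η ^ 3 * ∑ y ∈ U, f y ^ 2 ≤ 8 * blockConst 2 * (η * R) * (η * dOne (vmaVec (x - z))) ^ (-(2 : ℝ)) := by
    have : η ^ 3 * ∑ y ∈ U, f y ^ 2 = ∑ y ∈ U, η ^ 3 *
        ((η * dOne (vmaVec (x - y))) ^ (-(2 : ℝ)) * (η * dOne (vmaVec (y - z))) ^ (-(2 : ℝ))) := by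
      rw [mul_sum]; exact sum_congr rfl fun y _ => by rw [hf2]
    rw [this]; exact h130
  have hG : η ^ 3 * ∑ y ∈ U, g y ^ 2 ≤ blockConst 2 * (η * R) := by
    have : η ^ 3 * ∑ y ∈ U, g y ^ 2 = ∑ y ∈ U, η ^ 3 * (η * dOne (vmaVec (z - y))) ^ (-(2 : ℝ)) := by
      rw [mul_sum]; exact sum_congr rfl fun y _ => by rw [hg2]
    rw [this]; exact h129
  have hCS := Real.sum_mul_le_sqrt_mul_sqrt U f g
  have hc : 0 < η * dOne (vmaVec (x - z)) := hd x z
  have hC : 0 ≤ blockConst 2 := le_trans zero_le_one (one_le_blockConst (by norm_num))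
  have hηR : 0 ≤ η * R := mul_nonneg hη.le (Nat.cast_nonneg R)
  have hin : 0 ≤ 8 * blockConst 2 * (η * R) * (η * dOne (vmaVec (x - z))) ^ (-(2 : ℝ)) :=
    mul_nonneg (by positivity) (Real.rpow_nonneg hc.le _)
  calc ∑ y ∈ U, η ^ 3 * ((η * dOne (vmaVec (x - y))) ^ (-(1 : ℝ)) * (η * dOne (vmaVec (y - z))) ^ (-(2 : ℝ)))
      = η ^ 3 * ∑ y ∈ U, f y * g y := by
        rw [mul_sum]; exact sum_congr rfl fun y _ => by rw [hfg]
    _ ≤ η ^ 3 * (Real.sqrt (∑ y ∈ U, f y ^ 2) * Real.sqrt (∑ y ∈ U, g y ^ 2)) :=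
        mul_le_mul_of_nonneg_left hCS hη3
    _ = Real.sqrt (η ^ 3 * ∑ y ∈ U, f y ^ 2) * Real.sqrt (η ^ 3 * ∑ y ∈ U, g y ^ 2) := by
        rw [Real.sqrt_mul hη3, Real.sqrt_mul hη3,
          show Real.sqrt (η ^ 3) * Real.sqrt (∑ y ∈ U, f y ^ 2) * (Real.sqrt (η ^ 3) * Real.sqrt (∑ y ∈ U, g y ^ 2))
            = (Real.sqrt (η ^ 3) * Real.sqrt (η ^ 3)) *
              (Real.sqrt (∑ y ∈ U, f y ^ 2) * Real.sqrt (∑ y ∈ U, g y ^ 2)) by ring,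
          Real.mul_self_sqrt hη3]
    _ ≤ Real.sqrt (8 * blockConst 2 * (η * R) * (η * dOne (vmaVec (x - z))) ^ (-(2 : ℝ)))
          * Real.sqrt (blockConst 2 * (η * R)) :=
        mul_le_mul (Real.sqrt_le_sqrt hF) (Real.sqrt_le_sqrt hG) (Real.sqrt_nonneg _) (Real.sqrt_nonneg _)
    _ = Real.sqrt 8 * blockConst 2 * (η * R) * (η * dOne (vmaVec (x - z))) ^ (-(1 : ℝ)) := by
        rw [← Real.sqrt_mul hin, ← hsq _ hc,
          show 8 * blockConst 2 * (η * R) * ((η * dOne (vmaVec (x - z))) ^ (-(1 : ℝ))) ^ 2 * (blockConst 2 * (η * R))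
            = 8 * ((blockConst 2 * (η * R) * (η * dOne (vmaVec (x - z))) ^ (-(1 : ℝ))) *
                (blockConst 2 * (η * R) * (η * dOne (vmaVec (x - z))) ^ (-(1 : ℝ)))) by ring,
          Real.sqrt_mul (by norm_num : (0 : ℝ) ≤ 8), Real.sqrt_mul_self (by positivity)]
        ring

/-! ## §3 (154) on the torus: the block convolution hypothesis of THEOREM 1 -/

/-- **(154) ON THE TORUS «which follow from (130)»**: `Σ_{y∈U}η³·d′_T(u,y)^{−2}d′_T(y,v)^{−2} ≤ 2³C(2)(ηR)·d′_T(u,v)^{−2}` for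
every `U ⊂ (ℤ∕N)³` with `#U ≤ R³`; for unit blocks (`R = L^k` sites per side at `η = L^{−k}`, `ηR = 1`) the constant is
`8C(2)`, `C(2) = 289`. [cite: Dimock2004QED3TorusII, §3.2 proof of Thm 1 Part III (154) p.24 L95 – p.25 L1 and §3.1 Lemma 1 (130) p.21 L40–42] -/
theorem hconv_torus {η : ℝ} (hη : 0 < η) {R : ℕ} (hR : 1 ≤ R) (U : Finset (TPt 3 N)) (hcard : U.card ≤ R ^ 3)
    (u v : TPt 3 N) :
    ∑ y ∈ U, η ^ 3 * ((η * dOne (vmaVec (u - y))) ^ (-(2 : ℝ)) * (η * dOne (vmaVec (y - v))) ^ (-(2 : ℝ)))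
      ≤ (2 ^ ((2 : ℝ) + 1) * blockConst 2 * (η * R) ^ ((3 : ℝ) - 2)) * (η * dOne (vmaVec (u - v))) ^ (-(2 : ℝ)) := by
  have h := eq130_torus (α := 2) (by norm_num) (by norm_num) hη U hR hcard u v
  simpa only [mul_assoc] using h

/-- **(154) on the torus in the EXACT shape of the hypothesis `hconv` ∕ `hconv₀`** of the tree's `dimock_thm1` ∕
`dimock_thm1_torus`, for the printed profile `Q(u,v) = η³·d′_T(e u,e v)^{−2}` (the kernel `d′^{−2}` against the measure
`∫dy = Ση³`) on any site set `X` embedded injectively in the torus by `e`, with blocks `Δ` (the fibres of `β`) of at most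
`R³` sites: `Σ_{y : Δ_y = b}1·(Q(u,y)Q(y,v)) ≤ 2³C(2)(ηR)·Q(u,v)`.
[cite: Dimock2004QED3TorusII, §3.2 proof of Thm 1 Part III (153)–(154) p.24 L76 – p.25 L1] -/
theorem hconv_shape_torus {X B : Type*} [Fintype X] [DecidableEq B] (e : X → TPt 3 N) (he : Function.Injective e)
    (β : X → B) {η : ℝ} (hη : 0 < η) {R : ℕ} (hR : 1 ≤ R) (hblk : ∀ b, (univ.filter fun u => β u = b).card ≤ R ^ 3)
    (b : B) (u v : X) :
    ∑ y ∈ univ.filter (fun u => β u = b),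
        (1 : ℝ) * ((η ^ 3 * (η * dOne (vmaVec (e u - e y))) ^ (-(2 : ℝ)))
          * (η ^ 3 * (η * dOne (vmaVec (e y - e v))) ^ (-(2 : ℝ))))
      ≤ (2 ^ ((2 : ℝ) + 1) * blockConst 2 * (η * R) ^ ((3 : ℝ) - 2))
          * (η ^ 3 * (η * dOne (vmaVec (e u - e v))) ^ (-(2 : ℝ))) := by
  classical
  set Δ : Finset X := univ.filter fun u => β u = b with hΔ
  have hinj : ∀ y ∈ Δ, ∀ y' ∈ Δ, e y = e y' → y = y' := fun y _ y' _ h => he h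
  have hcard : (Δ.image e).card ≤ R ^ 3 := card_image_le.trans (hblk b)
  have h := hconv_torus hη hR (Δ.image e) hcard (e u) (e v)
  rw [sum_image hinj] at h
  have hη3 : 0 ≤ η ^ 3 := pow_nonneg hη.le 3
  calc ∑ y ∈ Δ, (1 : ℝ) * ((η ^ 3 * (η * dOne (vmaVec (e u - e y))) ^ (-(2 : ℝ)))
          * (η ^ 3 * (η * dOne (vmaVec (e y - e v))) ^ (-(2 : ℝ))))
      = η ^ 3 * ∑ y ∈ Δ, η ^ 3 * ((η * dOne (vmaVec (e u - e y))) ^ (-(2 : ℝ))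
          * (η * dOne (vmaVec (e y - e v))) ^ (-(2 : ℝ))) := by
        rw [mul_sum]
        exact sum_congr rfl fun y _ => by ring
    _ ≤ η ^ 3 * ((2 ^ ((2 : ℝ) + 1) * blockConst 2 * (η * R) ^ ((3 : ℝ) - 2))
          * (η * dOne (vmaVec (e u - e v))) ^ (-(2 : ℝ))) := mul_le_mul_of_nonneg_left h hη3
    _ = (2 ^ ((2 : ℝ) + 1) * blockConst 2 * (η * R) ^ ((3 : ℝ) - 2))
          * (η ^ 3 * (η * dOne (vmaVec (e u - e v))) ^ (-(2 : ℝ))) := by ring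


/-! ## §4 (202)–(203) on the torus: the block convolution hypotheses of THEOREM 2 (bosons) -/

/-- **(202) ON THE TORUS «by (129), (130), (131)»** for the boson profile `P = d′_T^{−1} + d′_T^{−2}`:
`Σ_{y∈U}η³·P(u,y)P(y,v) ≤ θ′·P(u,v)`, `θ′ = 4C(1)(ηR)² + 2√8C(2)(ηR) + 8C(2)(ηR)` (the four cross terms by (130)_T at
`α = 1`, (131)_T twice, (130)_T at `α = 2`; the tree's `hconv_Z3_boson`, ported). [cite: Dimock2004QED3TorusII, §3.3 proof of Thm 2 (202) p.30 L75–89 and §3.1 Lemma 1 (130)–(131) p.21 L40–45] -/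
theorem hconv_torus_boson {η : ℝ} (hη : 0 < η) {R : ℕ} (hR : 1 ≤ R) (U : Finset (TPt 3 N)) (hcard : U.card ≤ R ^ 3)
    (u v : TPt 3 N) :
    ∑ y ∈ U, η ^ 3 *
        (((η * dOne (vmaVec (u - y))) ^ (-(1 : ℝ)) + (η * dOne (vmaVec (u - y))) ^ (-(2 : ℝ))) *
          ((η * dOne (vmaVec (y - v))) ^ (-(1 : ℝ)) + (η * dOne (vmaVec (y - v))) ^ (-(2 : ℝ))))
      ≤ (2 ^ ((1 : ℝ) + 1) * blockConst 1 * (η * R) ^ ((3 : ℝ) - 1)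
          + 2 * (Real.sqrt 8 * blockConst 2 * (η * R))
          + 2 ^ ((2 : ℝ) + 1) * blockConst 2 * (η * R) ^ ((3 : ℝ) - 2))
        * ((η * dOne (vmaVec (u - v))) ^ (-(1 : ℝ)) + (η * dOne (vmaVec (u - v))) ^ (-(2 : ℝ))) := by
  have h11 := eq130_torus (α := 1) (by norm_num) (by norm_num) hη U hR hcard u v
  have h22 := eq130_torus (α := 2) (by norm_num) (by norm_num) hη U hR hcard u v
  have h12 := eq131_torus hη U hR hcard u v
  have h21 := eq131_torus hη U hR hcard v u
  have h21' : ∑ y ∈ U, η ^ 3 * ((η * dOne (vmaVec (u - y))) ^ (-(2 : ℝ)) * (η * dOne (vmaVec (y - v))) ^ (-(1 : ℝ)))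
      ≤ Real.sqrt 8 * blockConst 2 * (η * R) * (η * dOne (vmaVec (u - v))) ^ (-(1 : ℝ)) := by
    have e : ∀ y, (η * dOne (vmaVec (u - y))) ^ (-(2 : ℝ)) * (η * dOne (vmaVec (y - v))) ^ (-(1 : ℝ))
        = (η * dOne (vmaVec (v - y))) ^ (-(1 : ℝ)) * (η * dOne (vmaVec (y - u))) ^ (-(2 : ℝ)) := by
      intro y; rw [dOne_vmaVec_sub_comm u y, dOne_vmaVec_sub_comm y v, mul_comm]
    simp_rw [e]
    rw [dOne_vmaVec_sub_comm u v]
    exact h21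
  have hd1 : 0 ≤ (η * dOne (vmaVec (u - v))) ^ (-(1 : ℝ)) := Real.rpow_nonneg (dprimeT_pos hη u v).le _
  have hd2 : 0 ≤ (η * dOne (vmaVec (u - v))) ^ (-(2 : ℝ)) := Real.rpow_nonneg (dprimeT_pos hη u v).le _
  have hηR : 0 ≤ η * R := by positivity
  have hC1 : 0 ≤ blockConst 1 := zero_le_one.trans (one_le_blockConst (by norm_num))
  have hC2 : 0 ≤ blockConst 2 := zero_le_one.trans (one_le_blockConst (by norm_num))
  have hc11 : 0 ≤ 2 ^ ((1 : ℝ) + 1) * blockConst 1 * (η * R) ^ ((3 : ℝ) - 1) := by positivity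
  have hc12 : 0 ≤ Real.sqrt 8 * blockConst 2 * (η * R) := by positivity
  have hc22 : 0 ≤ 2 ^ ((2 : ℝ) + 1) * blockConst 2 * (η * R) ^ ((3 : ℝ) - 2) := by positivity
  have hexp : ∀ y, η ^ 3 *
      (((η * dOne (vmaVec (u - y))) ^ (-(1 : ℝ)) + (η * dOne (vmaVec (u - y))) ^ (-(2 : ℝ))) *
        ((η * dOne (vmaVec (y - v))) ^ (-(1 : ℝ)) + (η * dOne (vmaVec (y - v))) ^ (-(2 : ℝ))))
      = η ^ 3 * ((η * dOne (vmaVec (u - y))) ^ (-(1 : ℝ)) * (η * dOne (vmaVec (y - v))) ^ (-(1 : ℝ)))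
        + η ^ 3 * ((η * dOne (vmaVec (u - y))) ^ (-(1 : ℝ)) * (η * dOne (vmaVec (y - v))) ^ (-(2 : ℝ)))
        + η ^ 3 * ((η * dOne (vmaVec (u - y))) ^ (-(2 : ℝ)) * (η * dOne (vmaVec (y - v))) ^ (-(1 : ℝ)))
        + η ^ 3 * ((η * dOne (vmaVec (u - y))) ^ (-(2 : ℝ)) * (η * dOne (vmaVec (y - v))) ^ (-(2 : ℝ))) := by
    intro y; ring
  simp_rw [hexp]
  rw [sum_add_distrib, sum_add_distrib, sum_add_distrib]
  set c11 := 2 ^ ((1 : ℝ) + 1) * blockConst 1 * (η * R) ^ ((3 : ℝ) - 1)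
  set c12 := Real.sqrt 8 * blockConst 2 * (η * R)
  set c22 := 2 ^ ((2 : ℝ) + 1) * blockConst 2 * (η * R) ^ ((3 : ℝ) - 2)
  set D1 := (η * dOne (vmaVec (u - v))) ^ (-(1 : ℝ))
  set D2 := (η * dOne (vmaVec (u - v))) ^ (-(2 : ℝ))
  calc _ ≤ c11 * D1 + c12 * D1 + c12 * D1 + c22 * D2 :=
        add_le_add (add_le_add (add_le_add h11 h12) h21') h22
    _ ≤ (c11 + 2 * c12 + c22) * (D1 + D2) := by nlinarith
    _ = _ := by ring

/-- **(203) ON THE TORUS** — the boson chain's first-link step: `Σ_{y∈U}η³·d′_T(u,y)^{−1}·P(y,v) ≤ θ′·d′_T(u,v)^{−1}` with the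
`θ′` of `hconv_torus_boson` ((130)_T at `α = 1` and (131)_T; the surplus terms are `≥ 0`).
[cite: Dimock2004QED3TorusII, §3.3 proof of Thm 2 (203) p.31 L1–5 and §3.1 Lemma 1 (130)–(131) p.21 L40–45] -/
theorem hconv₀_torus_boson {η : ℝ} (hη : 0 < η) {R : ℕ} (hR : 1 ≤ R) (U : Finset (TPt 3 N)) (hcard : U.card ≤ R ^ 3)
    (u v : TPt 3 N) :
    ∑ y ∈ U, η ^ 3 *
        ((η * dOne (vmaVec (u - y))) ^ (-(1 : ℝ)) *
          ((η * dOne (vmaVec (y - v))) ^ (-(1 : ℝ)) + (η * dOne (vmaVec (y - v))) ^ (-(2 : ℝ))))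
      ≤ (2 ^ ((1 : ℝ) + 1) * blockConst 1 * (η * R) ^ ((3 : ℝ) - 1)
          + 2 * (Real.sqrt 8 * blockConst 2 * (η * R))
          + 2 ^ ((2 : ℝ) + 1) * blockConst 2 * (η * R) ^ ((3 : ℝ) - 2))
        * (η * dOne (vmaVec (u - v))) ^ (-(1 : ℝ)) := by
  have h11 := eq130_torus (α := 1) (by norm_num) (by norm_num) hη U hR hcard u v
  have h12 := eq131_torus hη U hR hcard u v
  have hd1 : 0 ≤ (η * dOne (vmaVec (u - v))) ^ (-(1 : ℝ)) := Real.rpow_nonneg (dprimeT_pos hη u v).le _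
  have hηR : 0 ≤ η * R := by positivity
  have hC2 : 0 ≤ blockConst 2 := zero_le_one.trans (one_le_blockConst (by norm_num))
  have hc12 : 0 ≤ Real.sqrt 8 * blockConst 2 * (η * R) := by positivity
  have hc22 : 0 ≤ 2 ^ ((2 : ℝ) + 1) * blockConst 2 * (η * R) ^ ((3 : ℝ) - 2) := by positivity
  have hexp : ∀ y, η ^ 3 * ((η * dOne (vmaVec (u - y))) ^ (-(1 : ℝ)) *
      ((η * dOne (vmaVec (y - v))) ^ (-(1 : ℝ)) + (η * dOne (vmaVec (y - v))) ^ (-(2 : ℝ))))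
      = η ^ 3 * ((η * dOne (vmaVec (u - y))) ^ (-(1 : ℝ)) * (η * dOne (vmaVec (y - v))) ^ (-(1 : ℝ)))
        + η ^ 3 * ((η * dOne (vmaVec (u - y))) ^ (-(1 : ℝ)) * (η * dOne (vmaVec (y - v))) ^ (-(2 : ℝ))) := by
    intro y; ring
  simp_rw [hexp]
  rw [sum_add_distrib]
  set c11 := 2 ^ ((1 : ℝ) + 1) * blockConst 1 * (η * R) ^ ((3 : ℝ) - 1)
  set c12 := Real.sqrt 8 * blockConst 2 * (η * R)
  set c22 := 2 ^ ((2 : ℝ) + 1) * blockConst 2 * (η * R) ^ ((3 : ℝ) - 2)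
  set D1 := (η * dOne (vmaVec (u - v))) ^ (-(1 : ℝ))
  calc _ ≤ c11 * D1 + c12 * D1 := add_le_add h11 h12
    _ ≤ (c11 + 2 * c12 + c22) * D1 := by nlinarith

omit [NeZero N] in
/-- **the shape conversion, generic**: a two-profile block bound on the torus `Σ_{y∈U}η³F(u,y)G(y,v) ≤ θK(u,v)` (all `U`
with `#U ≤ R³`) yields the `dimock_thm1`-shape `Σ_{y : Δ_y = b}1·((η³F(e u,e y))(η³G(e y,e v))) ≤ θ·(η³K(e u,e v))` on any site
set embedded injectively in the torus with blocks of `≤ R³` sites. [cite: Dimock2004QED3TorusII, §3.2 proof of Thm 1 Part III (153)–(154) p.24 L76 – p.25 L1] -/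
theorem conv_shape_of_torus {X B : Type*} [Fintype X] [DecidableEq B] (e : X → TPt 3 N) (he : Function.Injective e)
    (β : X → B) {η θ : ℝ} (hη : 0 < η) {R : ℕ} (hblk : ∀ b, (univ.filter fun u => β u = b).card ≤ R ^ 3)
    (F G K : TPt 3 N → TPt 3 N → ℝ)
    (hT : ∀ U : Finset (TPt 3 N), U.card ≤ R ^ 3 → ∀ u v, ∑ y ∈ U, η ^ 3 * (F u y * G y v) ≤ θ * K u v)
    (b : B) (u v : X) :
    ∑ y ∈ univ.filter (fun u => β u = b), (1 : ℝ) * ((η ^ 3 * F (e u) (e y)) * (η ^ 3 * G (e y) (e v)))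
      ≤ θ * (η ^ 3 * K (e u) (e v)) := by
  classical
  set Δ : Finset X := univ.filter fun u => β u = b with hΔ
  have hinj : ∀ y ∈ Δ, ∀ y' ∈ Δ, e y = e y' → y = y' := fun y _ y' _ h => he h
  have hcard : (Δ.image e).card ≤ R ^ 3 := card_image_le.trans (hblk b)
  have h := hT (Δ.image e) hcard (e u) (e v)
  rw [sum_image hinj] at h
  have hη3 : 0 ≤ η ^ 3 := pow_nonneg hη.le 3
  calc ∑ y ∈ Δ, (1 : ℝ) * ((η ^ 3 * F (e u) (e y)) * (η ^ 3 * G (e y) (e v)))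
      = η ^ 3 * ∑ y ∈ Δ, η ^ 3 * (F (e u) (e y) * G (e y) (e v)) := by
        rw [mul_sum]
        exact sum_congr rfl fun y _ => by ring
    _ ≤ η ^ 3 * (θ * K (e u) (e v)) := mul_le_mul_of_nonneg_left h hη3
    _ = θ * (η ^ 3 * K (e u) (e v)) := by ring

/-- **(202) on the torus in the EXACT shape of `hconv`** of `dimock_thm1` ∕ `dimock_thm1_torus` for the boson profile
`Q(u,v) = η³(d′_T^{−1} + d′_T^{−2})(e u,e v)`. [cite: Dimock2004QED3TorusII, §3.3 proof of Thm 2 (202) p.30 L75–89] -/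
theorem hconv_shape_torus_boson {X B : Type*} [Fintype X] [DecidableEq B] (e : X → TPt 3 N)
    (he : Function.Injective e) (β : X → B) {η : ℝ} (hη : 0 < η) {R : ℕ} (hR : 1 ≤ R)
    (hblk : ∀ b, (univ.filter fun u => β u = b).card ≤ R ^ 3) (b : B) (u v : X) :
    ∑ y ∈ univ.filter (fun u => β u = b), (1 : ℝ) *
        ((η ^ 3 * ((η * dOne (vmaVec (e u - e y))) ^ (-(1 : ℝ)) + (η * dOne (vmaVec (e u - e y))) ^ (-(2 : ℝ))))
          * (η ^ 3 * ((η * dOne (vmaVec (e y - e v))) ^ (-(1 : ℝ)) + (η * dOne (vmaVec (e y - e v))) ^ (-(2 : ℝ)))))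
      ≤ (2 ^ ((1 : ℝ) + 1) * blockConst 1 * (η * R) ^ ((3 : ℝ) - 1)
          + 2 * (Real.sqrt 8 * blockConst 2 * (η * R))
          + 2 ^ ((2 : ℝ) + 1) * blockConst 2 * (η * R) ^ ((3 : ℝ) - 2))
          * (η ^ 3 * ((η * dOne (vmaVec (e u - e v))) ^ (-(1 : ℝ)) + (η * dOne (vmaVec (e u - e v))) ^ (-(2 : ℝ)))) :=
  conv_shape_of_torus e he β hη hblk
    (fun a c => (η * dOne (vmaVec (a - c))) ^ (-(1 : ℝ)) + (η * dOne (vmaVec (a - c))) ^ (-(2 : ℝ)))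
    (fun a c => (η * dOne (vmaVec (a - c))) ^ (-(1 : ℝ)) + (η * dOne (vmaVec (a - c))) ^ (-(2 : ℝ)))
    (fun a c => (η * dOne (vmaVec (a - c))) ^ (-(1 : ℝ)) + (η * dOne (vmaVec (a - c))) ^ (-(2 : ℝ)))
    (fun U hU a c => hconv_torus_boson hη hR U hU a c) b u v

/-- **(203) on the torus in the EXACT shape of `hconv₀`** of `dimock_thm1` ∕ `dimock_thm1_torus` for the boson first-link
profile `P₀(u,v) = η³d′_T(e u,e v)^{−1}` against `Q = η³(d′_T^{−1} + d′_T^{−2})`. [cite: Dimock2004QED3TorusII, §3.3 proof of Thm 2 (203) p.31 L1–5] -/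
theorem hconv₀_shape_torus_boson {X B : Type*} [Fintype X] [DecidableEq B] (e : X → TPt 3 N)
    (he : Function.Injective e) (β : X → B) {η : ℝ} (hη : 0 < η) {R : ℕ} (hR : 1 ≤ R)
    (hblk : ∀ b, (univ.filter fun u => β u = b).card ≤ R ^ 3) (b : B) (u v : X) :
    ∑ y ∈ univ.filter (fun u => β u = b), (1 : ℝ) *
        ((η ^ 3 * (η * dOne (vmaVec (e u - e y))) ^ (-(1 : ℝ)))
          * (η ^ 3 * ((η * dOne (vmaVec (e y - e v))) ^ (-(1 : ℝ)) + (η * dOne (vmaVec (e y - e v))) ^ (-(2 : ℝ)))))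
      ≤ (2 ^ ((1 : ℝ) + 1) * blockConst 1 * (η * R) ^ ((3 : ℝ) - 1)
          + 2 * (Real.sqrt 8 * blockConst 2 * (η * R))
          + 2 ^ ((2 : ℝ) + 1) * blockConst 2 * (η * R) ^ ((3 : ℝ) - 2))
          * (η ^ 3 * (η * dOne (vmaVec (e u - e v))) ^ (-(1 : ℝ))) :=
  conv_shape_of_torus e he β hη hblk
    (fun a c => (η * dOne (vmaVec (a - c))) ^ (-(1 : ℝ)))
    (fun a c => (η * dOne (vmaVec (a - c))) ^ (-(1 : ℝ)) + (η * dOne (vmaVec (a - c))) ^ (-(2 : ℝ)))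
    (fun a c => (η * dOne (vmaVec (a - c))) ^ (-(1 : ℝ)))
    (fun U hU a c => hconv₀_torus_boson hη hR U hU a c) b u v

end QED3TorusII

end Literature.MathematicalPhysics.QuantumFieldTheory.Dimock2011to13
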